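import Literature.RepresentationTheory.HeisenbergGroup.StoneVonNeumannLatticePair
import Literature.RepresentationTheory.HeisenbergGroup.LatticeModelIrreducible
import HarnessLib

/-!
# An irreducibility CRITERION for unitary `ψ`-representations of a polarised Heisenberg group carrying a dual lattice pair:
# a lattice-fixed CYCLIC vector forces irreducibility (converse of "every non-zero vector of an irreducible representation is cyclic")

Topic `RepresentationTheory/HeisenbergGroup`; namespace `Literature.RepresentationTheory.HeisenbergGroup`.  KERNEL ONLY:
theorems; no definition, no named fact, no record, no `sorry`.

Setting of `StoneVonNeumannLatticePair.lean` ([MoeglinVignerasWaldspurger1987, Chap. 2 I.3, I.6–I.8]; [Weil1964, Chap. I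
n° 11, Chap. III n° 37–39]): `R` a commutative ring, `β : X →ₗ[R] Y →ₗ[R] R`, `ψ : R → S¹`, `H = Heisenberg (polar β)`,
`(B₁, B₂)` a dual lattice pair for `ψ(β x y)` (`IsDualLatticePair`), and `π` a representation of `H` on a complex Hilbert
space `E` by linear isometries with central character `ψ`.  A vector `v₀` is LATTICE-FIXED when `π(x, 0, 0) v₀ = v₀`
for `x ∈ B₁` and `π(0, y, 0) v₀ = v₀` for `y ∈ B₂`, and CYCLIC when the span of its orbit `π(H) v₀` is dense.

* §1 (abstract Hilbert-space lemma, `eq_smul_of_dense_span_of_inner_mul_inner`): if a family `e i` spans a dense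
  subspace and `⟪e i, u⟫ ⟪v₀, v₀⟫ = ⟪e i, v₀⟫ ⟪v₀, u⟫` for all `i` (the coefficients of `u` against the family are those
  of `v₀`, rescaled), then `u = (⟪v₀, u⟫ / ⟪v₀, v₀⟫) • v₀`;
* §2 **`latticeFixed_eq_smul_of_dense_span_orbit`** — MVW's "`S(ψ_A)` est de dimension `1`" [Chap. 2 I.6] in the form:
  if a lattice-fixed `v₀` is cyclic, EVERY lattice-fixed vector is a multiple of `v₀` (the coefficients
  `⟪π(h) v₀, u⟫` between lattice-fixed vectors are forced, `inner_apply_latticeFixed_latticeFixed`);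
* §3 **`irreducible_of_dense_span_orbit_latticeFixed`** — if some lattice-fixed vector is cyclic, the only closed
  `π`-invariant subspaces are `⊥` and `⊤`: the orthogonal projection `P_K` onto a closed invariant `K` commutes with
  `π` (unitarity), so `P_K v₀` is lattice-fixed, hence `c • v₀`; `c ≠ 0` puts `v₀` and its dense orbit span in `K`,
  `c = 0` puts them in `Kᗮ`.  This is the converse of `Unitary.dense_span_orbit_of_irreducible` for lattice-fixed
  vectors, and the criterion by which the irreducibility of CONCRETE models (`ℓ²`-lattice models, `L²(𝐀_fⁿ)`,
  `L²` of the adèles [GelbartRogawski1991, §3.1 p. 454 L19–21: "let `ρ_ψ` be an irreducible unitary representation of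
  `H_𝐀(W)`"]) reduces to the density of ONE orbit — no Haar measure, no commutant computation.

Nothing of the cited sources is asserted; everything is proved from Mathlib and the tree.

## References
* [MoeglinVignerasWaldspurger1987] C. Mœglin, M.-F. Vignéras, J.-L. Waldspurger, *Correspondances de Howe sur un corps
  p-adique*, LNM 1291 (1987), Chap. 2 I.3, I.6 ("`S(ψ_A)` est de dimension 1"), I.8.
* [Weil1964] A. Weil, Acta Math. 111 (1964), Chap. I n° 11–12, Chap. III n° 37–39.
* [GelbartRogawski1991] S. Gelbart, J. Rogawski, Invent. Math. 105 (1991), §3.1 p. 454 L19–21.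
* [Dixmier1977] J. Dixmier, *C\*-algebras* (1977), §13.1.1 (cyclic vectors; invariant subspaces and their complements).
-/

set_option autoImplicit false

noncomputable section

open Set Filter Topology
open scoped InnerProductSpace ComplexConjugate

namespace Literature.RepresentationTheory.HeisenbergGroup

/-! ## §1 A dense family whose coefficients against `u` are those against `v₀` forces `u ∈ ℂ v₀` -/

section Abstract

variable {E : Type*} [NormedAddCommGroup E] [InnerProductSpace ℂ E] [CompleteSpace E]

/-- **a vector whose coefficients against a total family are proportional to those of `v₀` is a multiple of `v₀`**:
if the `e i` span a dense subspace, `v₀ ≠ 0`, and `⟪e i, u⟫ ⟪v₀, v₀⟫ = ⟪e i, v₀⟫ ⟪v₀, u⟫` for every `i`, then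
`u = (⟪v₀, u⟫ / ⟪v₀, v₀⟫) • v₀` (the difference is orthogonal to every `e i`, hence to a dense subspace).
[cite: Dixmier1977, §13.1.1] -/
theorem eq_smul_of_dense_span_of_inner_mul_inner {ι : Type*} (e : ι → E)
    (he : Dense (Submodule.span ℂ (Set.range e) : Set E)) {v₀ u : E} (hv₀ : v₀ ≠ 0)
    (h : ∀ i, ⟪e i, u⟫_ℂ * ⟪v₀, v₀⟫_ℂ = ⟪e i, v₀⟫_ℂ * ⟪v₀, u⟫_ℂ) :
    u = (⟪v₀, u⟫_ℂ / ⟪v₀, v₀⟫_ℂ) • v₀ := by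
  have hvv : ⟪v₀, v₀⟫_ℂ ≠ 0 := inner_self_ne_zero.2 hv₀
  set c : ℂ := ⟪v₀, u⟫_ℂ / ⟪v₀, v₀⟫_ℂ with hc
  -- `u - c • v₀` is orthogonal to the span of the `e i`
  have horth : u - c • v₀ ∈ (Submodule.span ℂ (Set.range e))ᗮ := by
    rw [Submodule.mem_orthogonal]
    intro w hw
    induction hw using Submodule.span_induction with
    | mem w hw =>
      obtain ⟨i, rfl⟩ := hw
      rw [inner_sub_right, inner_smul_right, hc]
      field_simp
      linear_combination h i
    | zero => rw [inner_zero_left]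
    | add w w' _ _ hw hw' => rw [inner_add_left, hw, hw', add_zero]
    | smul a w _ hw => rw [inner_smul_left, hw, mul_zero]
  have hbot : (Submodule.span ℂ (Set.range e))ᗮ = ⊥ := by
    rw [← Submodule.topologicalClosure_eq_top_iff, ← Submodule.dense_iff_topologicalClosure_eq_top]
    exact he
  rw [hbot, Submodule.mem_bot, sub_eq_zero] at horth
  exact horth

omit [CompleteSpace E] in
/-- the span of a family lies in every submodule containing the family; if moreover the span is dense and the submodule
is closed, the submodule is `⊤`. [cite: Dixmier1977, §13.1.1] -/
theorem eq_top_of_dense_span_of_range_subset {ι : Type*} (e : ι → E)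
    (he : Dense (Submodule.span ℂ (Set.range e) : Set E)) {K : Submodule ℂ E} (hKc : IsClosed (K : Set E))
    (hK : ∀ i, e i ∈ K) : K = ⊤ := by
  have hle : Submodule.span ℂ (Set.range e) ≤ K := Submodule.span_le.2 (Set.range_subset_iff.2 hK)
  have hcl : (Submodule.span ℂ (Set.range e)).topologicalClosure ≤ K := by
    rw [← hKc.submodule_topologicalClosure_eq]
    exact Submodule.topologicalClosure_mono hle
  rw [Submodule.dense_iff_topologicalClosure_eq_top] at he
  rw [he] at hcl
  exact top_le_iff.1 hcl

end Abstract

/-! ## §2 A cyclic lattice-fixed vector spans the lattice-fixed vectors -/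

section LatticePair

variable {R : Type*} [CommRing R] {X Y : Type*} [AddCommGroup X] [Module R X] [AddCommGroup Y] [Module R Y]
  [TopologicalSpace X] [TopologicalSpace Y] (β : X →ₗ[R] Y →ₗ[R] R) (ψ : AddChar R Circle)
  {B₁ : AddSubgroup X} {B₂ : AddSubgroup Y}
  {E : Type*} [NormedAddCommGroup E] [InnerProductSpace ℂ E] [CompleteSpace E]
  (π : Representation ℂ (Heisenberg (polar β)) E)
  (hπu : ∀ (h : Heisenberg (polar β)) (v : E), ‖π h v‖ = ‖v‖)
  (hπz : ∀ (t : R) (v : E), π (Heisenberg.ofCenter (polar β) (Multiplicative.ofAdd t)) v = ((ψ t : Circle) : ℂ) • v)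

include hπu in
omit [TopologicalSpace X] [TopologicalSpace Y] [CompleteSpace E] in
/-- `Kᗮ` is invariant when `K` is, for a representation by isometries. [cite: Dixmier1977, §13.1.1] -/
theorem apply_mem_orthogonal_of_invariant {K : Submodule ℂ E} (hK : ∀ (h : Heisenberg (polar β)), ∀ v ∈ K, π h v ∈ K)
    (h : Heisenberg (polar β)) {w : E} (hw : w ∈ Kᗮ) : π h w ∈ Kᗮ := by
  rw [Submodule.mem_orthogonal] at hw ⊢
  intro k hk
  have hk' : π h (π h⁻¹ k) = k := by rw [← Module.End.mul_apply, ← map_mul, mul_inv_cancel, map_one, Module.End.one_apply]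
  rw [← hk', Unitary.inner_apply_apply π hπu]
  exact hw _ (hK h⁻¹ k hk)

include hπu in
omit [TopologicalSpace X] [TopologicalSpace Y] [CompleteSpace E] in
/-- the orthogonal projection onto a closed invariant subspace commutes with the representation.
[cite: Dixmier1977, §13.1.1] -/
theorem starProjection_apply_of_invariant {K : Submodule ℂ E} [K.HasOrthogonalProjection]
    (hK : ∀ (h : Heisenberg (polar β)), ∀ v ∈ K, π h v ∈ K) (h : Heisenberg (polar β)) (v : E) :
    K.starProjection (π h v) = π h (K.starProjection v) := by
  have hinv : ∀ w, π h (π h⁻¹ w) = w := fun w => by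
    rw [← Module.End.mul_apply, ← map_mul, mul_inv_cancel, map_one, Module.End.one_apply]
  exact LatticeModel.starProjection_map_of_invariant K ⟨π h, hπu h⟩ (π h⁻¹) hinv (hK h) (hK h⁻¹) v

variable {v₀ : E} (hτ₀ : ∀ x ∈ B₁, π ⟨(x, 0), 0⟩ v₀ = v₀) (hμ₀ : ∀ y ∈ B₂, π ⟨(0, y), 0⟩ v₀ = v₀)
  (hd : Dense (Submodule.span ℂ (Set.range fun h : Heisenberg (polar β) => π h v₀) : Set E))

include hπu hπz hτ₀ hμ₀ hd

/-- **"`S(ψ_A)` is one-dimensional", cyclic form**: for a dual lattice pair `(B₁, B₂)` and an isometric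
`ψ`-representation `π` of `Heisenberg (polar β)`, if a lattice-fixed vector `v₀` is cyclic (its orbit spans a dense
subspace) then every lattice-fixed vector `u` equals `(⟪v₀, u⟫ / ⟪v₀, v₀⟫) • v₀` — the coefficients `⟪π(h) v₀, u⟫` and
`⟪π(h) v₀, v₀⟫` are both `(1_{B₁ × B₂} · ψ̄)(h)` times `⟪v₀, ·⟫` (`inner_apply_latticeFixed_latticeFixed`).
[cite: MoeglinVignerasWaldspurger1987, Chap. 2 I.6] -/
theorem latticeFixed_eq_smul_of_dense_span_orbit (hB : IsDualLatticePair β ψ B₁ B₂) {u : E}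
    (hτu : ∀ x ∈ B₁, π ⟨(x, 0), 0⟩ u = u) (hμu : ∀ y ∈ B₂, π ⟨(0, y), 0⟩ u = u) :
    u = (⟪v₀, u⟫_ℂ / ⟪v₀, v₀⟫_ℂ) • v₀ := by
  by_cases hv₀ : v₀ = 0
  · -- the orbit of `0` is `{0}`, whose span is dense only in the zero space
    have htop : (⊥ : Submodule ℂ E) = ⊤ := by
      refine eq_top_of_dense_span_of_range_subset (fun h : Heisenberg (polar β) => π h v₀) hd
        (by rw [Submodule.bot_coe]; exact isClosed_singleton) fun h => ?_
      rw [hv₀, map_zero]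
      exact Submodule.zero_mem _
    have hu : u ∈ (⊥ : Submodule ℂ E) := by rw [htop]; exact Submodule.mem_top
    rw [Submodule.mem_bot] at hu
    rw [hu, hv₀, smul_zero]
  · refine eq_smul_of_dense_span_of_inner_mul_inner (fun h : Heisenberg (polar β) => π h v₀) hd hv₀ fun h => ?_
    rw [inner_apply_latticeFixed_latticeFixed β ψ π hπu hπz hτ₀ hμ₀ hτu hμu hB h,
      inner_apply_latticeFixed_latticeFixed β ψ π hπu hπz hτ₀ hμ₀ hτ₀ hμ₀ hB h]
    ring

/-! ## §3 The irreducibility criterion -/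

/-- **irreducibility from a cyclic lattice-fixed vector.**  `(B₁, B₂)` a dual lattice pair for `ψ(β x y)`; `π` a
representation of `Heisenberg (polar β)` on a complex Hilbert space by linear isometries with central character `ψ`;
`v₀` a lattice-fixed vector whose orbit spans a dense subspace.  Then a closed `π`-invariant subspace `K` is `⊥` or
`⊤`: `P_K v₀` is lattice-fixed (the projection commutes with `π`), hence `c • v₀` by
`latticeFixed_eq_smul_of_dense_span_orbit`; if `v₀ ∈ K` the dense orbit span lies in `K`, otherwise `c = 0`, `v₀ ∈ Kᗮ`
and the orbit span lies in the closed invariant `Kᗮ`.  (Converse of "every non-zero vector of an irreducible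
representation is cyclic", `Unitary.dense_span_orbit_of_irreducible`, for lattice-fixed vectors.)
[cite: MoeglinVignerasWaldspurger1987, Chap. 2 I.6, I.8] -/
theorem irreducible_of_dense_span_orbit_latticeFixed (hB : IsDualLatticePair β ψ B₁ B₂) (K : Submodule ℂ E)
    (hKc : IsClosed (K : Set E)) (hK : ∀ (h : Heisenberg (polar β)), ∀ v ∈ K, π h v ∈ K) : K = ⊥ ∨ K = ⊤ := by
  haveI : CompleteSpace K := hKc.completeSpace_coe
  haveI : K.HasOrthogonalProjection := Submodule.HasOrthogonalProjection.ofCompleteSpace K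
  by_cases hvK : v₀ ∈ K
  · right
    exact eq_top_of_dense_span_of_range_subset (fun h : Heisenberg (polar β) => π h v₀) hd hKc fun h => hK h v₀ hvK
  · left
    -- `P_K v₀` is lattice-fixed, hence a multiple of `v₀`; the multiple is `0` since `v₀ ∉ K`
    have hPτ : ∀ x ∈ B₁, π ⟨(x, 0), 0⟩ (K.starProjection v₀) = K.starProjection v₀ := fun x hx => by
      rw [← starProjection_apply_of_invariant β π hπu hK, hτ₀ x hx]
    have hPμ : ∀ y ∈ B₂, π ⟨(0, y), 0⟩ (K.starProjection v₀) = K.starProjection v₀ := fun y hy => by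
      rw [← starProjection_apply_of_invariant β π hπu hK, hμ₀ y hy]
    have hP := latticeFixed_eq_smul_of_dense_span_orbit β ψ π hπu hπz hτ₀ hμ₀ hd hB hPτ hPμ
    set c : ℂ := ⟪v₀, K.starProjection v₀⟫_ℂ / ⟪v₀, v₀⟫_ℂ with hc
    have hc0 : c = 0 := by
      by_contra hc0
      apply hvK
      have : v₀ = c⁻¹ • K.starProjection v₀ := by rw [hP, smul_smul, inv_mul_cancel₀ hc0, one_smul]
      rw [this]
      exact K.smul_mem _ (K.starProjection_apply_mem v₀)
    have hv₀K : v₀ ∈ Kᗮ := by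
      rw [← Submodule.starProjection_apply_eq_zero_iff (K := K), hP, hc0, zero_smul]
    -- the orbit span lies in the closed invariant subspace `Kᗮ`, which is therefore `⊤`
    have htop : Kᗮ = ⊤ :=
      eq_top_of_dense_span_of_range_subset (fun h : Heisenberg (polar β) => π h v₀) hd
        (Submodule.isClosed_orthogonal K) fun h => apply_mem_orthogonal_of_invariant β π hπu hK h hv₀K
    exact (Submodule.orthogonal_eq_top_iff (K := K)).1 htop

end LatticePair

end Literature.RepresentationTheory.HeisenbergGroup

end

/-! ## §4 (appendix) Consequences of "`S(ψ_A)` is one-dimensional" -/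

namespace Literature.RepresentationTheory.HeisenbergGroup

open scoped InnerProductSpace

variable {R : Type*} [CommRing R] {X Y : Type*} [AddCommGroup X] [Module R X] [AddCommGroup Y] [Module R Y]
  [TopologicalSpace X] [TopologicalSpace Y] (β : X →ₗ[R] Y →ₗ[R] R) (ψ : AddChar R Circle)
  {B₁ : AddSubgroup X} {B₂ : AddSubgroup Y}
  {E : Type*} [NormedAddCommGroup E] [InnerProductSpace ℂ E] [CompleteSpace E]
  (π : Representation ℂ (Heisenberg (polar β)) E)
  (hπu : ∀ (h : Heisenberg (polar β)) (v : E), ‖π h v‖ = ‖v‖)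
  (hπz : ∀ (t : R) (v : E), π (Heisenberg.ofCenter (polar β) (Multiplicative.ofAdd t)) v = ((ψ t : Circle) : ℂ) • v)
  {v₀ : E} (hτ₀ : ∀ x ∈ B₁, π ⟨(x, 0), 0⟩ v₀ = v₀) (hμ₀ : ∀ y ∈ B₂, π ⟨(0, y), 0⟩ v₀ = v₀)
  (hd : Dense (Submodule.span ℂ (Set.range fun h : Heisenberg (polar β) => π h v₀) : Set E))

include hπu hπz hτ₀ hμ₀ hd in
/-- **a lattice-fixed vector orthogonal to the cyclic lattice-fixed vector vanishes** (the lattice-fixed line is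
`ℂ v₀`): with the data of `latticeFixed_eq_smul_of_dense_span_orbit`, `⟪v₀, u⟫ = 0` forces `u = 0` — the form in which
multiplicity one is used to identify intertwiners on the smooth vectors. [cite: MoeglinVignerasWaldspurger1987, Chap. 2 I.6] -/
theorem latticeFixed_eq_zero_of_inner_eq_zero_of_dense_span (hB : IsDualLatticePair β ψ B₁ B₂) {u : E}
    (hτu : ∀ x ∈ B₁, π ⟨(x, 0), 0⟩ u = u) (hμu : ∀ y ∈ B₂, π ⟨(0, y), 0⟩ u = u) (h0 : ⟪v₀, u⟫_ℂ = 0) : u = 0 := by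
  rw [latticeFixed_eq_smul_of_dense_span_orbit β ψ π hπu hπz hτ₀ hμ₀ hd hB hτu hμu, h0, zero_div, zero_smul]

include hπu hπz hτ₀ hμ₀ hd in
/-- **two lattice-fixed vectors are linearly dependent** (`S(ψ_A)` is a line): `⟪v₀, v₀⟫ • u = ⟪v₀, u⟫ • v₀`.
[cite: MoeglinVignerasWaldspurger1987, Chap. 2 I.6] -/
theorem inner_self_smul_latticeFixed_eq_of_dense_span (hB : IsDualLatticePair β ψ B₁ B₂) {u : E}
    (hτu : ∀ x ∈ B₁, π ⟨(x, 0), 0⟩ u = u) (hμu : ∀ y ∈ B₂, π ⟨(0, y), 0⟩ u = u) :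
    ⟪v₀, v₀⟫_ℂ • u = ⟪v₀, u⟫_ℂ • v₀ := by
  by_cases hv : v₀ = 0
  · have hu := latticeFixed_eq_smul_of_dense_span_orbit β ψ π hπu hπz hτ₀ hμ₀ hd hB hτu hμu
    rw [hv, smul_zero] at hu
    simp only [hu, hv, smul_zero]
  · have hne : ⟪v₀, v₀⟫_ℂ ≠ 0 := inner_self_ne_zero.2 hv
    have hu := latticeFixed_eq_smul_of_dense_span_orbit β ψ π hπu hπz hτ₀ hμ₀ hd hB hτu hμu
    calc ⟪v₀, v₀⟫_ℂ • u = ⟪v₀, v₀⟫_ℂ • ((⟪v₀, u⟫_ℂ / ⟪v₀, v₀⟫_ℂ) • v₀) := by rw [← hu]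
      _ = ⟪v₀, u⟫_ℂ • v₀ := by rw [smul_smul, mul_div_cancel₀ _ hne]

end Literature.RepresentationTheory.HeisenbergGroup
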